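import Summits.Ventures.CertifiedArithmetic.LowPrec.EnvelopeAtoms
import Summits.Ventures.CertifiedArithmetic.LowPrec.Successor
import Summits.Ventures.CertifiedArithmetic.LowPrec.MXQuantize
import Mathlib.Algebra.Order.Round

/-!
# GEMM-level envelopes, part (c): the witness values (pub-lowprec gemm gen 22, LXX-c)

HONEST FRAMING: certified error envelopes and provably optimal rounding/accumulation schemes for
low-precision formats under stated cost models; every table by two implementations; no hardware or
vendor claims.

Value-level facts the decision-table rows (part d) use as WITNESSES: interval roundings in OCP E4M3 /
E5M2 obtained from the kernel's value table through the unique-nearest principle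
(`toRat_roundNE_eq_of_forall_lt`), block-max and scale evaluation for the witness blocks of the
two-implementation certificate `certs/gemm/GEMM-ENVELOPES.json` (W1 all-272, W2 all-500, W4 deep block,
W5 approach family, P6 E5M2), and the absolute-error product decomposition for the `F2` rows.
Theorems only; every concrete number here is reproduced with 0 diff by both certificate pipelines
(`code/gemm/envelope/pipeA.py`, `pipeB.py`). [cite: RouhaniEtAl2023MX, §5.1, §6.1];
[cite: MicikeviciusEtAl2022, §3]; [cite: Higham2002ASNA, §3.1]
-/

namespace Summit.Ventures.CertifiedArithmetic.LowPrec.GemmEnvelope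

open Finset
open Literature.ComputerArithmetic.FloatingPoint
open Literature.ComputerArithmetic.FloatingPoint.Format
open Literature.ComputerArithmetic.FloatingPoint.MiniFloat
open Literature.ComputerArithmetic.FloatingPoint.MXBlock
open Summit.Ventures.CertifiedArithmetic.LowPrec.SR

/-! ## Interval roundings (the approach families of W5 / P2 / P6) -/

/-- Every rational in `(272, 288]` rounds to `288` in E4M3 (RNE): `272` is the midpoint of the
consecutive values `256, 288`. [folklore] -/
theorem toRat_roundNE_E4M3_eq_288 {x : ℚ} (h1 : 272 < x) (h2 : x ≤ 288) :
    (roundNE E4M3 x).toRat = 288 := by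
  have h256 : (roundNE E4M3 256).toRat = 256 := by decide +kernel
  have h288 : (roundNE E4M3 288).toRat = 288 := by decide +kernel
  have hall : ((all E4M3).all fun y => decide (y.toRat ≤ 256 ∨ 288 ≤ y.toRat)) = true := by
    decide +kernel
  have hgap : ∀ y : MiniFloat E4M3,
      y.toRat ≤ (roundNE E4M3 256).toRat ∨ (roundNE E4M3 256).toRat + 32 ≤ y.toRat := by
    intro y
    have hy := of_decide_eq_true (forall_of_all_all hall y)
    rw [h256]
    rcases hy with hy | hy
    · exact Or.inl hy
    · exact Or.inr (by linarith)
  have hu : (roundNE E4M3 288).toRat = (roundNE E4M3 256).toRat + 32 := by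
    rw [h256, h288]; norm_num
  have key := forall_lt_of_mem_high (x := x) hu hgap (by rw [h256]; linarith)
    (by rw [h256]; linarith)
  rw [h288] at key
  exact toRat_roundNE_eq_of_forall_lt ⟨roundNE E4M3 288, h288⟩ key

/-- Every rational in `(36864, 40960]` rounds to `40960` in E5M2 (RNE). [folklore] -/
theorem toRat_roundNE_E5M2_eq_40960 {x : ℚ} (h1 : 36864 < x) (h2 : x ≤ 40960) :
    (roundNE E5M2 x).toRat = 40960 := by
  have hlo : (roundNE E5M2 32768).toRat = 32768 := by decide +kernel
  have hhi : (roundNE E5M2 40960).toRat = 40960 := by decide +kernel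
  have hall : ((all E5M2).all fun y => decide (y.toRat ≤ 32768 ∨ 40960 ≤ y.toRat)) = true := by
    decide +kernel
  have hgap : ∀ y : MiniFloat E5M2,
      y.toRat ≤ (roundNE E5M2 32768).toRat ∨ (roundNE E5M2 32768).toRat + 8192 ≤ y.toRat := by
    intro y
    have hy := of_decide_eq_true (forall_of_all_all hall y)
    rw [hlo]
    rcases hy with hy | hy
    · exact Or.inl hy
    · exact Or.inr (by linarith)
  have hu : (roundNE E5M2 40960).toRat = (roundNE E5M2 32768).toRat + 8192 := by
    rw [hlo, hhi]; norm_num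
  have key := forall_lt_of_mem_high (x := x) hu hgap (by rw [hlo]; linarith)
    (by rw [hlo]; linarith)
  rw [hhi] at key
  exact toRat_roundNE_eq_of_forall_lt ⟨roundNE E5M2 40960, hhi⟩ key

/-- Kernel point values used by the witnesses (W1: `272 ↦ 256` ties-to-even; W2: `500 ↦ 448`
saturating, `250 ↦ 256`; W4: `11/1024 ↦ 12/1024`; W5/INT8: `17 ↦ 16` and Mathlib's `round (17/2) = 9`
(ties up); P6: `38000 ↦ 40960`; format constants). [cite: MicikeviciusEtAl2022, §3, Table 1] -/
theorem witness_values :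
    (roundNE E4M3 272).toRat = 256 ∧ (roundNE E4M3 500).toRat = 448 ∧
    (roundNE E4M3 250).toRat = 256 ∧ (roundNE E4M3 (11 / 1024)).toRat = 12 / 1024 ∧
    (roundNE E4M3 17).toRat = 16 ∧ round ((17 : ℚ) / 2) = 9 ∧
    (roundNE E5M2 38000).toRat = 40960 ∧ E4M3.maxRat = 448 ∧ E5M2.maxRat = 57344 ∧
    E4M3.emaxElem = 8 ∧ E4M3.unitRoundoff = 1 / 16 ∧ E5M2.unitRoundoff = 1 / 8 := by
  refine ⟨by decide +kernel, by decide +kernel, by decide +kernel, by decide +kernel,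
    by decide +kernel, ?_, by decide +kernel, by decide +kernel, by decide +kernel,
    emaxElem_values.1, by decide +kernel, by decide +kernel⟩
  rw [round_eq]; norm_num

/-! ## Block max and scale evaluation -/

/-- A uniform bound on the entries bounds the block max. [folklore] -/
theorem blockMax_le_of_forall_le {k : ℕ} {V : Fin k → ℚ} {c : ℚ} (hc : 0 ≤ c)
    (h : ∀ i, |V i| ≤ c) : blockMax V ≤ c := by
  show Finset.univ.fold max 0 (fun i => |V i|) ≤ c
  exact (Finset.fold_max_le c).mpr ⟨hc, fun i _ => h i⟩

/-- An attained uniform bound IS the block max. [folklore] -/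
theorem blockMax_eq_of_forall_le {k : ℕ} {V : Fin k → ℚ} {c : ℚ} (h : ∀ i, |V i| ≤ c) {i₀ : Fin k}
    (h₀ : |V i₀| = c) : blockMax V = c :=
  le_antisymm (blockMax_le_of_forall_le (h₀ ▸ abs_nonneg _) h) (h₀ ▸ abs_le_blockMax V i₀)

/-- The block max of a constant nonempty block. [folklore] -/
theorem blockMax_const (n : ℕ) (x : ℚ) : blockMax (fun _ : Fin (n + 1) => x) = |x| :=
  blockMax_eq_of_forall_le (fun _ => le_rfl) (i₀ := 0) rfl

/-- CEIL scale evaluation: if `2^e · maxRat / 2 < blockMax V ≤ 2^e · maxRat` then `X_ceil = 2^e`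
(minimality + no-clipping). [cite: RouhaniEtAl2023MX, §6.3] -/
theorem ceilScale_eq_zpow {φ : Format} (hM : 0 < φ.maxRat) {k : ℕ} {V : Fin k → ℚ} {e : ℤ}
    (hlo : (2 : ℚ) ^ e * φ.maxRat / 2 < blockMax V) (hhi : blockMax V ≤ (2 : ℚ) ^ e * φ.maxRat) :
    ceilScale φ V = (2 : ℚ) ^ e := by
  have hV : 0 < blockMax V :=
    lt_of_le_of_lt (by positivity : (0 : ℚ) ≤ (2 : ℚ) ^ e * φ.maxRat / 2) hlo
  have h1 : ceilExp φ V ≤ e := ceilExp_le_of_le hM hV hhi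
  have h2 : e ≤ ceilExp φ V := by
    by_contra hlt
    push Not at hlt
    have hle : ceilScale φ V ≤ (2 : ℚ) ^ (e - 1) := by
      unfold ceilScale; exact zpow_le_zpow_right₀ (by norm_num) (by omega)
    have hc := blockMax_le_ceilScale_mul hM V
    have : (2 : ℚ) ^ (e - 1) = (2 : ℚ) ^ e / 2 := by
      rw [zpow_sub_one₀ (by norm_num : (2 : ℚ) ≠ 0)]; ring
    rw [this] at hle
    nlinarith
  unfold ceilScale
  rw [le_antisymm h1 h2]

/-- FLOOR (OCP) scale evaluation: if `2^f ≤ blockMax V < 2^(f+1)` then `X_floor = 2^(f − emaxElem)`.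
[cite: RouhaniEtAl2023MX, §6.3] -/
theorem scaleRat_eq_zpow {φ : Format} {k : ℕ} {V : Fin k → ℚ} {f : ℤ}
    (hlo : (2 : ℚ) ^ f ≤ blockMax V) (hhi : blockMax V < (2 : ℚ) ^ (f + 1)) :
    scaleRat φ V = (2 : ℚ) ^ (f - φ.emaxElem) := by
  have hV : 0 < blockMax V := lt_of_lt_of_le (zpow_pos (by norm_num) f) hlo
  have h1 : f ≤ Int.log 2 (blockMax V) :=
    (Int.zpow_le_iff_le_log (by norm_num) hV).mp (by exact_mod_cast hlo)
  have h2 : Int.log 2 (blockMax V) < f + 1 :=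
    (Int.lt_zpow_iff_log_lt (by norm_num) hV).mp (by exact_mod_cast hhi)
  unfold scaleRat sharedExp
  rw [show Int.log 2 (blockMax V) = f by omega]

/-- W5 / P2 / P3 family: a constant block with value in `(272, 288]` has CEIL scale `1` in E4M3 and
dequantises to `288`. [cite: RouhaniEtAl2023MX, §6.1] -/
theorem mxCeil_const_eq_288 (n : ℕ) {x : ℚ} (h1 : 272 < x) (h2 : x ≤ 288) (i : Fin (n + 1)) :
    ceilScale E4M3 (fun _ : Fin (n + 1) => x) *
      (roundNE E4M3 ((fun _ : Fin (n + 1) => x) i / ceilScale E4M3 (fun _ : Fin (n + 1) => x))).toRat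
      = 288 := by
  have hM : E4M3.maxRat = 448 := by decide +kernel
  have hX : ceilScale E4M3 (fun _ : Fin (n + 1) => x) = (2 : ℚ) ^ (0 : ℤ) :=
    ceilScale_eq_zpow (by rw [hM]; norm_num)
      (by rw [blockMax_const, hM, abs_of_pos (by linarith)]; norm_num; linarith)
      (by rw [blockMax_const, hM, abs_of_pos (by linarith)]; norm_num; linarith)
  rw [hX, zpow_zero, div_one, one_mul]
  exact toRat_roundNE_E4M3_eq_288 h1 h2

/-- W1: the all-`272` block (scale `1`) dequantises to `256` under CEIL (ties-to-even at the midpoint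
of `256, 288`): relative error `1/17` per element, `33/289` per product — INSIDE the envelope and
not at its sup. [cite: RouhaniEtAl2023MX, §6.1] -/
theorem mxCeil_const_272 (n : ℕ) (i : Fin (n + 1)) :
    ceilScale E4M3 (fun _ : Fin (n + 1) => (272 : ℚ)) *
      (roundNE E4M3 ((fun _ : Fin (n + 1) => (272 : ℚ)) i /
        ceilScale E4M3 (fun _ : Fin (n + 1) => (272 : ℚ)))).toRat = 256 := by
  have hM : E4M3.maxRat = 448 := by decide +kernel
  have hX : ceilScale E4M3 (fun _ : Fin (n + 1) => (272 : ℚ)) = (2 : ℚ) ^ (0 : ℤ) :=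
    ceilScale_eq_zpow (by rw [hM]; norm_num) (by rw [blockMax_const, hM]; norm_num)
      (by rw [blockMax_const, hM]; norm_num)
  rw [hX, zpow_zero, div_one, one_mul]
  exact witness_values.1

/-- W2 / P7: the all-`500` block.  CEIL: scale `2`, `250 ↦ 256`, value `512` (relative `3/125`);
FLOOR (OCP): scale `2^(8−8) = 1`, `500 ↦ 448` saturating (relative `13/125`).
[cite: RouhaniEtAl2023MX, §6.3]; [cite: RouhaniEtAl2023MX, §6.3] -/
theorem mx_const_500 (n : ℕ) (i : Fin (n + 1)) :
    ceilScale E4M3 (fun _ : Fin (n + 1) => (500 : ℚ)) *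
      (roundNE E4M3 ((fun _ : Fin (n + 1) => (500 : ℚ)) i /
        ceilScale E4M3 (fun _ : Fin (n + 1) => (500 : ℚ)))).toRat = 512 ∧
    scaleRat E4M3 (fun _ : Fin (n + 1) => (500 : ℚ)) *
      (roundNE E4M3 ((fun _ : Fin (n + 1) => (500 : ℚ)) i /
        scaleRat E4M3 (fun _ : Fin (n + 1) => (500 : ℚ)))).toRat = 448 := by
  have hM : E4M3.maxRat = 448 := by decide +kernel
  constructor
  · have hX : ceilScale E4M3 (fun _ : Fin (n + 1) => (500 : ℚ)) = (2 : ℚ) ^ (1 : ℤ) :=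
      ceilScale_eq_zpow (by rw [hM]; norm_num) (by rw [blockMax_const, hM]; norm_num)
        (by rw [blockMax_const, hM]; norm_num)
    rw [hX, zpow_one, show (500 : ℚ) / 2 = 250 by norm_num, witness_values.2.2.1]; norm_num
  · have hX : scaleRat E4M3 (fun _ : Fin (n + 1) => (500 : ℚ)) = (2 : ℚ) ^ ((8 : ℤ) - E4M3.emaxElem) :=
      scaleRat_eq_zpow (by rw [blockMax_const]; norm_num) (by rw [blockMax_const]; norm_num)
    rw [hX, emaxElem_values.1, sub_self, zpow_zero, div_one, one_mul]
    exact witness_values.2.1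

/-- W4 (deep regime): the block `(225, 11/1024, …, 11/1024)` has CEIL scale `1` (block max `225`,
just above `maxRat/2 = 224`); the small entries sit at `5.5` quanta and round to `6` quanta `= 12/1024`
(relative `1/11`), the head `225 ↦ 224`. [cite: RouhaniEtAl2023MX, §6.1] -/
theorem mxCeil_deep_block (n : ℕ) :
    ceilScale E4M3 (Fin.cases (225 : ℚ) (fun _ : Fin (n + 1) => 11 / 1024)) = 1 ∧
    (roundNE E4M3 ((11 : ℚ) / 1024)).toRat = 12 / 1024 ∧ (roundNE E4M3 (225 : ℚ)).toRat = 224 := by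
  have hM : E4M3.maxRat = 448 := by decide +kernel
  have hb : blockMax (Fin.cases (225 : ℚ) (fun _ : Fin (n + 1) => 11 / 1024) : Fin (n + 2) → ℚ)
      = 225 := by
    refine blockMax_eq_of_forall_le (fun i => ?_) (i₀ := 0) (by simp)
    refine Fin.cases ?_ (fun j => ?_) i
    · simp
    · simp only [Fin.cases_succ]; rw [abs_of_pos (by norm_num)]; norm_num
  refine ⟨?_, by decide +kernel, by decide +kernel⟩
  have := ceilScale_eq_zpow (φ := E4M3) (e := 0) (by rw [hM]; norm_num)
    (V := (Fin.cases (225 : ℚ) (fun _ : Fin (n + 1) => 11 / 1024) : Fin (n + 2) → ℚ))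
    (by rw [hb, hM]; norm_num) (by rw [hb, hM]; norm_num)
  rw [this, zpow_zero]

/-! ## Absolute-error decomposition (functional `F2`) -/

/-- E-DEC in ABSOLUTE form: uniform absolute operand errors `ea, eb` and magnitude bounds `A, B'`
give `|Σ q̂a·q̂b − Σ a·b| ≤ card · (A·eb + ea·B' + ea·eb)`. [cite: Higham2002ASNA, §3.1] -/
theorem abs_sum_mul_sub_sum_mul_le_abs_unif {ι : Type*} [Fintype ι] {a b qa qb : ι → ℚ}
    {ea eb A B' : ℚ} (hea : 0 ≤ ea) (ha : ∀ i, |qa i - a i| ≤ ea) (hb : ∀ i, |qb i - b i| ≤ eb)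
    (hA : ∀ i, |a i| ≤ A) (hB : ∀ i, |b i| ≤ B') :
    |∑ i, qa i * qb i - ∑ i, a i * b i| ≤ Fintype.card ι * (A * eb + ea * B' + ea * eb) := by
  have hpt : ∀ i, |qa i * qb i - a i * b i| ≤ A * eb + ea * B' + ea * eb := by
    intro i
    have e1 : qa i * qb i - a i * b i
        = a i * (qb i - b i) + (qa i - a i) * b i + (qa i - a i) * (qb i - b i) := by ring
    rw [e1]
    have t1 := abs_add_le (a i * (qb i - b i) + (qa i - a i) * b i) ((qa i - a i) * (qb i - b i))
    have t2 := abs_add_le (a i * (qb i - b i)) ((qa i - a i) * b i)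
    rw [abs_mul] at t1
    rw [abs_mul, abs_mul] at t2
    have heb : 0 ≤ eb := le_trans (abs_nonneg _) (hb i)
    have m1 : |a i| * |qb i - b i| ≤ A * eb :=
      mul_le_mul (hA i) (hb i) (abs_nonneg _) (le_trans (abs_nonneg _) (hA i))
    have m2 : |qa i - a i| * |b i| ≤ ea * B' :=
      mul_le_mul (ha i) (hB i) (abs_nonneg _) hea
    have m3 : |qa i - a i| * |qb i - b i| ≤ ea * eb :=
      mul_le_mul (ha i) (hb i) (abs_nonneg _) hea
    linarith
  calc |∑ i, qa i * qb i - ∑ i, a i * b i| = |∑ i, (qa i * qb i - a i * b i)| := by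
        rw [Finset.sum_sub_distrib]
    _ ≤ ∑ i, |qa i * qb i - a i * b i| := Finset.abs_sum_le_sum_abs _ _
    _ ≤ ∑ _i : ι, (A * eb + ea * B' + ea * eb) := Finset.sum_le_sum fun i _ => hpt i
    _ = Fintype.card ι * (A * eb + ea * B' + ea * eb) := by
        rw [Finset.sum_const, nsmul_eq_mul]; rfl

/-- Per-vector FP with covering numerator `A` (scale `A / maxRat`): ABSOLUTE element error
`≤ A · (u · 2^emaxElem / maxRat)` for every `|v| ≤ A` (no normality needed; E4M3: `A/28`).
[cite: MicikeviciusEtAl2022, §3]; [cite: Higham2002ASNA, Thm 2.2] -/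
theorem vec_abs_error_le (φ : Format) (h1 : 1 ≤ φ.emaxCode) (hM : 0 < φ.maxRat) {A v : ℚ}
    (hv : |v| ≤ A) (hA : 0 < A) :
    |A / φ.maxRat * (roundNE φ (v / (A / φ.maxRat))).toRat - v|
      ≤ A * (φ.unitRoundoff * (2 : ℚ) ^ φ.emaxElem / φ.maxRat) := by
  have hs : 0 < A / φ.maxRat := div_pos hA hM
  have hin : |v / (A / φ.maxRat)| ≤ φ.maxRat := by
    rw [abs_div, abs_of_pos hs, div_le_iff₀ hs]
    calc |v| ≤ A := hv
      _ = φ.maxRat * (A / φ.maxRat) := by field_simp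
  have h := abs_sub_roundNE_le_unitRoundoff_mul_pow_emaxElem h1 hin
  have e1 : A / φ.maxRat * (roundNE φ (v / (A / φ.maxRat))).toRat - v
      = -((A / φ.maxRat) * (v / (A / φ.maxRat) - (roundNE φ (v / (A / φ.maxRat))).toRat)) := by
    field_simp; ring
  rw [e1, abs_neg, abs_mul, abs_of_pos hs]
  calc A / φ.maxRat * |v / (A / φ.maxRat) - (roundNE φ (v / (A / φ.maxRat))).toRat|
      ≤ A / φ.maxRat * (φ.unitRoundoff * (2 : ℚ) ^ φ.emaxElem) :=
        mul_le_mul_of_nonneg_left h hs.le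
    _ = A * (φ.unitRoundoff * (2 : ℚ) ^ φ.emaxElem / φ.maxRat) := by ring

/-- E4M3 instance: absolute element error `≤ A / 28`; the symmetric INT8 quantiser gives `≤ A / 254`
(`intQ_abs_error_le` of part b with `s = A/127`). [cite: MicikeviciusEtAl2022, §3] -/
theorem vec_abs_error_le_E4M3 {A v : ℚ} (hv : |v| ≤ A) (hA : 0 < A) :
    |A / E4M3.maxRat * (roundNE E4M3 (v / (A / E4M3.maxRat))).toRat - v| ≤ A / 28 := by
  have h := vec_abs_error_le E4M3 (by decide) (by decide +kernel) hv hA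
  have hc : E4M3.unitRoundoff * (2 : ℚ) ^ E4M3.emaxElem / E4M3.maxRat = 1 / 28 := by
    rw [emaxElem_values.1, witness_values.2.2.2.2.2.2.2.1, witness_values.2.2.2.2.2.2.2.2.2.2.1]
    norm_num
  rw [hc] at h
  linarith

end Summit.Ventures.CertifiedArithmetic.LowPrec.GemmEnvelope
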